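import Summits.Ventures.QEC.Census.CSSK1SplitLPSound
import HarnessLib

/-!
# The split linear program of the `k = 1` CSS normal form with SEPARATE `Z`- and `X`-distance thresholds

LADDER-QEC (venture cell `qec`), type-10 lane, cell `(16, 1)`. `Census/CSSK1SplitLP.lean` builds the `k = 1` split system at ONE distance
`d` for both sectors; here the same rows with `(Z)` at `d^Z ≥ dZ` and `(X)` at `d^X ≥ dX` (`k1Rows₂ b w c dZ dX mw`: the excluded primal
types `zeroTriples b w c dZ`, the information-block rows, and the split-MacWilliams rows `rowMW b w c dX t` whose `(X)`-equalities use `dX`).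
`lpFeasible_k1Rows₂` / `false_of_farkasCheck₂` are the two-threshold twins of the one-threshold theorems (same proof). WHY: for a CSS
`[[16,1,≥5]]` code with `rank H^Z = 8` the one-threshold program is feasible at translate weights `w ∈ {5, 7}`, but the `X`-distance is in
fact `≥ 7` (the MIRROR program `(b, w') = (7, w')` of the `X ↔ Z`-swapped code is infeasible at `w' ∈ {5, 6, 9}`, and a minimum-weight
`X`-logical is stabilizer-free, hence the translate of some information set — `Census/CSS/K1LP16X.lean`), and at `(dZ, dX) = (5, 7)` the
program is infeasible at EVERY `w` (certificates `Census/CSS/K1LP16CertsB8X.lean`). [folklore] (weak LP duality; split MacWilliams).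
-/

namespace Summit.Ventures.QEC.Census.CSSK1LP

open Finset Matrix Literature.InformationTheory.Coding Literature.InformationTheory.QuantumCodes

section LP2

/-- **The two-threshold `k = 1` CSS split linear system** at `(b, w, c, dZ, dX)` with the split-MacWilliams rows listed in `mw`. [folklore] -/
def k1Rows₂ (b w c dZ dX : ℕ) (mw : List (ℕ × ℕ × ℕ)) : List LPRow :=
  rowUnit (enc w c (0, 0, 0)) 1 ::
    (((zeroTriples b w c dZ).map fun t => rowUnit (enc w c t) 0) ++
      (((List.range b).map fun i => rowP1 b w c (i + 1)) ++ (mw.map fun t => rowMW b w c dX t)))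

variable {κ μ : Type*} [Fintype κ] [Fintype μ] [DecidableEq κ] [DecidableEq μ]

/-- **Feasibility (two thresholds).** If `(P, S)` satisfies `(Z)` at `dZ` and `(X)` at `dX` (split-weight form) then its split weight
distribution is a feasible point of `k1Rows₂`. [folklore] -/
theorem lpFeasible_k1Rows₂ (P : Matrix κ μ (ZMod 2)) (S : Finset μ) (dZ dX : ℕ)
    (hZ : ∀ v : κ → ZMod 2, dZ ≤ wtOn univ v + (#S - wtOn S (v ᵥ* P)) + wtOn Sᶜ (v ᵥ* P))
    (hX : ∀ u : μ → ZMod 2, wtOn S u % 2 = 1 → dX ≤ wtOn univ u + wtOn univ (P *ᵥ u))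
    (mw : List (ℕ × ℕ × ℕ)) :
    LPFeasible (k1Rows₂ (Fintype.card κ) #S #Sᶜ dZ dX mw) (k1N (Fintype.card κ) #S #Sᶜ) (alphaOf P S) (fun _ => 0) := by
  classical
  refine ⟨fun r => by unfold alphaOf; positivity, fun _ => le_rfl, ?_⟩
  intro row hrow
  simp only [k1Rows₂, List.mem_cons, List.mem_append, List.mem_map] at hrow
  -- the evaluation of a row with `cB = 0`
  have hev : ∀ (cA : ℕ → ℚ) (rhs : ℚ) (e : Bool),
      (⟨cA, fun _ => 0, rhs, e⟩ : LPRow).eval (k1N (Fintype.card κ) #S #Sᶜ) (alphaOf P S) (fun _ => 0) =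
        ∑ v : κ → ZMod 2, cA (enc #S #Sᶜ (typeA P S v)) := by
    intro cA rhs e
    rw [LPRow.eval, ← sum_mul_alphaOf P S cA]
    simp
  rcases hrow with rfl | ⟨t, ht, rfl⟩ | ⟨i, hi, rfl⟩ | ⟨t, ht, rfl⟩
  · -- α_{(0,0,0)} = 1
    refine ⟨fun _ => ?_, fun h => by simp [rowUnit] at h⟩
    rw [rowUnit, hev]
    simp only
    have : ∀ v : κ → ZMod 2, (if enc #S #Sᶜ (typeA P S v) = enc #S #Sᶜ (0, 0, 0) then (1 : ℚ) else 0) =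
        if v = 0 then 1 else 0 := by
      intro v
      obtain ⟨_, h2, h3⟩ := typeA_le P S v
      have hiff : enc #S #Sᶜ (typeA P S v) = enc #S #Sᶜ (0, 0, 0) ↔ v = 0 := by
        constructor
        · intro h
          have := dec_enc #S #Sᶜ h2 h3
          rw [h, dec_enc #S #Sᶜ (by simp) (by simp)] at this
          have h0 : (typeA P S v).1 = 0 := by rw [← this]
          exact (wtOn_univ_eq_zero_iff v).mp h0
        · rintro rfl
          simp [typeA, Matrix.zero_vecMul]
      simp only [hiff]
    simp_rw [this]
    rw [Finset.sum_ite_eq']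
    simp
  · -- excluded types
    refine ⟨fun _ => ?_, fun h => by simp [rowUnit] at h⟩
    rw [rowUnit, hev]
    simp only
    have htmem := ht
    simp only [zeroTriples, triples, List.mem_filter, List.mem_flatMap, List.mem_map, List.mem_range,
      decide_eq_true_eq] at htmem
    obtain ⟨⟨i, hi, j, hj, l, hl, rfl⟩, hcond⟩ := htmem
    refine Finset.sum_eq_zero fun v _ => ?_
    rw [if_neg]
    intro h
    obtain ⟨_, h2, h3⟩ := typeA_le P S v
    have htv : typeA P S v = (i, j, l) := by
      rw [← dec_enc #S #Sᶜ h2 h3, h, dec_enc #S #Sᶜ (by simpa using Nat.lt_succ_iff.mp hj) (by simpa using Nat.lt_succ_iff.mp hl)]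
    rcases hcond with ⟨hi0, hne⟩ | ⟨hi1, hle⟩
    · simp only at hi0
      subst hi0
      have hv0 : v = 0 := (wtOn_univ_eq_zero_iff v).mp (by have := congrArg Prod.fst htv; simpa [typeA] using this)
      subst hv0
      apply hne
      simp [typeA, Matrix.zero_vecMul] at htv
      rw [← htv.1, ← htv.2]
    · have hz := hZ v
      simp only [typeA, Prod.mk.injEq] at htv
      obtain ⟨h1, h2', h3'⟩ := htv
      rw [h1, h2', h3'] at hz
      simp only at hi1 hle
      omega
  · -- information-block rows
    refine ⟨fun _ => ?_, fun h => by simp [rowP1] at h⟩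
    rw [rowP1, hev]
    simp only
    have : ∀ v : κ → ZMod 2, (if di #S #Sᶜ (enc #S #Sᶜ (typeA P S v)) = i + 1 then (1 : ℚ) else 0) =
        if hammingNorm v = i + 1 then 1 else 0 := by
      intro v
      obtain ⟨_, h2, h3⟩ := typeA_le P S v
      rw [di_enc #S #Sᶜ h2 h3]
      rfl
    simp_rw [this]
    rw [Finset.sum_boole, PerfectCode.card_filter_hammingNorm_eq]
  · -- split-MacWilliams rows
    have hevt : (rowMW (Fintype.card κ) #S #Sᶜ dX t).eval (k1N (Fintype.card κ) #S #Sᶜ) (alphaOf P S) (fun _ => 0) =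
        (2 : ℚ) ^ Fintype.card κ *
          #((univ : Finset (μ → ZMod 2)).filter fun u =>
              wtOn univ (P *ᵥ u) = t.1 ∧ wtOn S u = t.2.1 ∧ wtOn Sᶜ u = t.2.2) := by
      rw [rowMW, hev]
      have : ∀ v : κ → ZMod 2, kprodQ (Fintype.card κ) #S #Sᶜ t (di #S #Sᶜ (enc #S #Sᶜ (typeA P S v)))
          (dj #S #Sᶜ (enc #S #Sᶜ (typeA P S v))) (dl #S #Sᶜ (enc #S #Sᶜ (typeA P S v))) =
            (kprod P S t.1 t.2.1 t.2.2 v : ℚ) := by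
        intro v
        obtain ⟨_, h2, h3⟩ := typeA_le P S v
        rw [di_enc #S #Sᶜ h2 h3, dj_enc #S #Sᶜ h2 h3, dl_enc #S #Sᶜ h3]
        rfl
      simp_rw [this]
      rw [← Int.cast_sum, sum_kprod_eq]
      push_cast
      ring
    refine ⟨fun heq => ?_, fun _ => ?_⟩
    · -- (X)-excluded dual type: no `u` of that type
      rw [hevt]
      simp only [rowMW]
      have hx : xcCond dX t = true := heq
      simp only [xcCond, decide_eq_true_eq] at hx
      rw [Finset.card_eq_zero.mpr, Nat.cast_zero, mul_zero]
      refine Finset.filter_eq_empty_iff.mpr fun u _ ⟨h1, h2, h3⟩ => ?_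
      have := hX u (by rw [h2]; exact hx.1)
      rw [wtOn_univ_eq_add S u, h1, h2, h3] at this
      omega
    · rw [hevt]
      simp only [rowMW]
      positivity

/-- **Infeasibility certificate ⇒ no normal form (two thresholds).** [folklore] -/
theorem false_of_farkasCheck₂ (P : Matrix κ μ (ZMod 2)) (S : Finset μ) {b w c dZ dX : ℕ} {mw : List (ℕ × ℕ × ℕ)}
    {ys : List ℚ} (hc : farkasCheck (k1Rows₂ b w c dZ dX mw) ys (k1N b w c) = true)
    (hb : Fintype.card κ = b) (hw : #S = w) (hcc : #Sᶜ = c)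
    (hZ : ∀ v : κ → ZMod 2, dZ ≤ wtOn univ v + (#S - wtOn S (v ᵥ* P)) + wtOn Sᶜ (v ᵥ* P))
    (hX : ∀ u : μ → ZMod 2, wtOn S u % 2 = 1 → dX ≤ wtOn univ u + wtOn univ (P *ᵥ u)) : False := by
  subst hb hw hcc
  exact not_lpFeasible_of_farkasCheck hc (lpFeasible_k1Rows₂ P S dZ dX hZ hX mw)

end LP2

end Summit.Ventures.QEC.Census.CSSK1LP
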